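import Literature.NumberTheory.GaloisCohomology.Howard2004.DVRSettingEngineLiftProofs
import Literature.NumberTheory.GaloisCohomology.Howard2004.DVRSelmerATorsionControlProofs
import Literature.NumberTheory.GaloisCohomology.Howard2004.DVRKolyvaginBoundProofs
import Literature.Algebra.Module.TorsionHomCountingDVR
import HarnessLib

/-!
# Howard 2004, Lemma 1.6.4 on a FULL `DVRSetting`: the engine binder `hlam`
# («`Stub^{(k)}(n) ≠ 0` ⇒ `i = λ^{(k)}(n) < k` and `Stub^{(i)}(n) = 0») — proofs file (ENGINE-hlam)

B. Howard, *The Heegner point Kolyvagin system*, Compositio Math. **140** (2004) (arXiv:1202.6340), proof of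
Lemma 1.6.4, first case (arXiv p. 11 L85 – p. 12 L1): «First suppose `Stub^{(k)}(n) ≠ 0`, so that in particular
we are in the case `ε = 1`, and `λ^{(k)}(n) < k`.  Let `i = λ^{(k)}(n)`. … By Lemma (H.5 application)
[`H¹_{F(n)}(K, T^{(i)}) ≅ H¹_{F(n)}(K, T^{(k)})[𝔪^i]`] … `λ^{(i)}(n) = λ^{(k)}(n) = i`.  This implies that
`Stub^{(i)}(n) = 0`».

This file DISCHARGES the hypothesis `hlam` of the cell's induction ENGINE
(`mem_stub_of_stubLemmaInduction_levels'`, `DVRSettingEngineData` §4) on a `DVRSetting` `S` with H.0–H.5 whose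
levels are FULL (`e_j = j + 1`, the clause of `thm161_of_full_tame`; the refined setting `S.refine`), in the
letters of the data layer (`DVRSettingEngineStub`): `P k = S.enginePrimes k`, `Stub k n = S.stub hy hdec k n`,
`λ^{(k)}(n) = S.stubLength hy hdec k n`, and the LEVEL LETTER **`lam k n := S.stubLength hy hdec k n - 1`** (the
level index of exponent `λ^{(k)}(n)`; Howard indexes levels by their exponent, the tree by `j` with `e_j = j+1`).

* §1 `exists_injective_linearMap_quotient_span_pow` — the `R`-linear injection `R/(π^a) ↪ R/(π^b)`,
  `x ↦ π^{b-a} x` (`a ≤ b`), with image killed by `π^a` (pure algebra).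
* §2 (the CHOSEN decomposition behind `stubLength` is x10b-p1-w7's `exists_decomposition_stubLength_eq`,
  `DVRSettingEngineLiftProofs`) `exists_linearEquiv_selmerModuleAt` — a decomposition
  `H¹_{F(n)}(K,T^{(k)}) ≃ (Fin ε → R/𝔪^{e_k}) × (M × M)` as an `R`-LINEAR equivalence of the engine's module
  `H k n = ↥(S.selmerModuleAt hy k n)`; `length_selmerModuleAt_eq` — `len H¹_{F(n)}(K,T^{(k)}) = ε·e_k + 2·len M`;
  `stub_eq_bot_iff`.
* §3 `length_selmerModuleAt_lower_bound` — Lemma 1.3.3 AT LEVEL `n` (x10b-p1-w2's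
  `exists_mem_selmerGroup_atLevel_incH1LE_eq` / `incH1LE_mem_selmerGroup_atLevel_iff`, the trivial-action
  hypothesis discharged by `toLocal_apply_eq_self_of_ker_eq_bot` on `𝓝(𝓛^{(2k-1)})`) read in LENGTHS: if level
  `k`'s decomposition has `π^{e_i} M = 0` then `ε·e_i + 2·len M ≤ len H¹_{F(n)}(K, T^{(i)})` (the submodule
  `(π^{e_k-e_i}R/𝔪^{e_k})^ε × M × M` of `H¹_{F(n)}(K,T^{(k)})[𝔪^{e_i}] = inc(H¹_{F(n)}(K,T^{(i)}))`).
* §4 `stub_eq_bot_of_stubLength_eq_e` — for `i ≤ k`, `Stub^{(k)}(n) ≠ 0` and `λ^{(k)}(n) = e_i`: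
  `Stub^{(i)}(n) = 0` (Howard's «`λ^{(i)}(n) = λ^{(k)}(n) = i`», here as `λ^{(i)}(n) ≥ e_i` by the length count
  `ε_i e_i + 2λ^{(i)} ≥ e_i + 2e_i`, `ε = 1` being forced by `Stub^{(k)}(n) ≠ 0`).
* §5 **`stub_eq_top_or_stub_stubLength_pred_eq_bot`** — ON A FULL SETTING the engine binder
  `hlam : ∀ k n, ↑n ⊆ P k → Stub k n ≠ ⊥ → Stub k n = ⊤ ∨ (lam k n < k ∧ Stub (lam k n) n = ⊥)` with
  `lam k n = λ^{(k)}(n) - 1`, and **`engine_hlam`** (the binder verbatim, `fun k n => S.stubLength hy hdec k n - 1`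
  in the `lam` slot).

THEOREMS ONLY: no definition, no named fact, no instance, no notation, no `sorry`.  HONEST FRAMING: one hypothesis
of the engine is discharged; the levelwise structure Thm. 1.4.2 stays the hypothesis `hdec`; Lemma 1.6.4, Thm. 1.6.1
and `thm161_dvrKolyvaginBound` are NOT proved here; no summit statement is proved; the Birch–Swinnerton-Dyer
conjecture is not proved by any of this.

References: [Howard2004HeegnerKolyvagin] Lemma 1.3.3, Def. 1.5.4, Lemma 1.6.4 proof (arXiv p. 7 L152–160, p. 10
L56–60, p. 11 L85 – p. 12 L1); [MazurRubinMemoirs2004] Lemma 3.5.4.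
-/

set_option autoImplicit false

noncomputable section

open Function NumberField IsDedekindDomain Field
open scoped NumberField ContRepresentation Classical

namespace Literature.NumberTheory.GaloisCohomology.Howard2004

open Literature.NumberTheory.GaloisRepresentations
open Literature.NumberTheory.GaloisRepresentations.DiscreteGaloisModule

/-! ## §1 Pure algebra: `R/(π^a) ↪ R/(π^b)`, `x ↦ π^{b-a}x` -/

/-- For `a ≤ b` and `π ≠ 0` in a domain, `x ↦ π^{b-a} x` is an injective `R`-linear map `R/(π^a) → R/I`,
`I = (π^b)`, whose image is killed by `π^a` (it is the `π^a`-torsion `(π^{b-a})/(π^b)` of `R/(π^b)`).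
[cite: Howard2004HeegnerKolyvagin, Lemma 1.3.3 (arXiv p. 7 L152–160: `R/𝔪^i = (R/𝔪^k)[𝔪^i]`)] -/
theorem exists_injective_linearMap_quotient_span_pow {R : Type*} [CommRing R] [IsDomain R] {π : R}
    (hπ : π ≠ 0) {a b : ℕ} (hab : a ≤ b) (I : Ideal R) (hI : I = Ideal.span {π ^ b}) :
    ∃ ι : (R ⧸ Ideal.span {π ^ a}) →ₗ[R] (R ⧸ I), Function.Injective ι ∧ ∀ x, π ^ a • ι x = 0 := by
  subst hI
  have hba : π ^ (b - a) * π ^ a = π ^ b := by rw [← pow_add, Nat.sub_add_cancel hab]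
  let f : R →ₗ[R] (R ⧸ Ideal.span {π ^ b}) :=
    (Submodule.mkQ (Ideal.span {π ^ b})).comp (LinearMap.mulLeft R (π ^ (b - a)))
  have hf : ∀ r : R, f r = Submodule.Quotient.mk (π ^ (b - a) * r) := fun r => rfl
  have hle : Ideal.span {π ^ a} ≤ LinearMap.ker f := by
    rw [Ideal.span_le]
    rintro x hx
    rw [Set.mem_singleton_iff] at hx
    subst hx
    change f (π ^ a) = 0
    rw [hf, hba, Submodule.Quotient.mk_eq_zero]
    exact Ideal.mem_span_singleton_self _
  have hker : LinearMap.ker f ≤ Ideal.span {π ^ a} := by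
    intro r hr
    rw [LinearMap.mem_ker, hf, Submodule.Quotient.mk_eq_zero, Ideal.mem_span_singleton, ← hba] at hr
    exact Ideal.mem_span_singleton.2 ((mul_dvd_mul_iff_left (pow_ne_zero _ hπ)).1 hr)
  refine ⟨(Ideal.span {π ^ a}).liftQ f hle, ?_, fun x => ?_⟩
  · rw [← LinearMap.ker_eq_bot]
    exact Submodule.ker_liftQ_eq_bot _ _ _ hker
  · obtain ⟨r, rfl⟩ := Submodule.Quotient.mk_surjective _ x
    change π ^ a • (Ideal.span {π ^ a}).liftQ f hle (Submodule.Quotient.mk r) = 0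
    rw [Submodule.liftQ_apply, hf, ← Submodule.Quotient.mk_smul, smul_eq_mul, ← mul_assoc, mul_comm (π ^ a),
      hba, Submodule.Quotient.mk_eq_zero]
    exact Ideal.mem_span_singleton.2 (dvd_mul_right _ _)

namespace DVRSetting

variable {p : ℕ} [Fact p.Prime] {K : Type} [Field K] [NumberField K]
  {R : Type} [CommRing R] [IsDomain R] [IsDiscreteValuationRing R] [Algebra ℤ_[p] R]
  {N : ℕ → Type} [∀ k, AddCommGroup (N k)] [∀ k, TopologicalSpace (N k)]
  [∀ k, DiscreteTopology (N k)] [∀ k, Module R (N k)]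
  {Rk : ℕ → Type} [∀ k, CommRing (Rk k)] [∀ k, IsLocalRing (Rk k)] [∀ k, TopologicalSpace (Rk k)]
  [∀ k, DiscreteTopology (Rk k)] [∀ k, Algebra ℤ_[p] (Rk k)] [∀ k, Algebra R (Rk k)]
  [∀ k, Module (Rk k) (N k)] [∀ k, IsScalarTower R (Rk k) (N k)]
  {Nbar : Type} [AddCommGroup Nbar] [TopologicalSpace Nbar] [DiscreteTopology Nbar]
  [∀ k, Module (Rk k) Nbar]
  {Nq : ℕ → Finset (HeightOneSpectrum (𝓞 K)) → Type} [∀ k n, AddCommGroup (Nq k n)]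
  [∀ k n, TopologicalSpace (Nq k n)] [∀ k n, DiscreteTopology (Nq k n)]
  [∀ k n, Module (Rk k) (Nq k n)] [∀ k n, Module R (Nq k n)]
  [∀ k n, IsScalarTower R (Rk k) (Nq k n)]

/-! ## §2 The chosen decomposition behind `λ^{(k)}(n)`; `H¹_{F(n)}(K, T^{(k)})` as an `R`-module -/

/-- **`H¹_{F(n)}(K, T^{(k)}) ≅ (Fin ε → R/𝔪^{e_k}) × (M × M)` as `R`-MODULES**: an additive `R`-equivariant
decomposition is an `R`-linear equivalence of the engine's module `H k n = ↥(S.selmerModuleAt hy k n)` (functorial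
scalar action `moduleH1`). [cite: Howard2004HeegnerKolyvagin, Thm. 1.4.2 applied to (T^{(k)}, F(n)) and Lemma 1.6.4 (arXiv p. 8 L99–105, p. 11 L88–90)] -/
theorem exists_linearEquiv_selmerModuleAt (S : DVRSetting p K R N Rk Nbar Nq) (hy : S.SatisfiesH) (k : ℕ)
    (n : Finset (HeightOneSpectrum (𝓞 K))) {ε : ℕ} {M : Type} [AddCommGroup M] [Module R M]
    (θ : ↥((((S.t k).atLevel S.jbar n).cond).selmerGroup) ≃+
      ((Fin ε → R ⧸ IsLocalRing.maximalIdeal R ^ S.e k) × (M × M)))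
    (hθ : ∀ (r : R) (y : galoisCohomology (S.T.ρ k) 1) (hy' : y ∈ (((S.t k).atLevel S.jbar n).cond).selmerGroup),
      θ ⟨galoisCohomology.scalarMapH1 (S.T.ρ k) (S.T.hlin k) r y,
          S.scalarMapH1_mem_selmerGroup_atLevel hy k n r hy'⟩ = r • θ ⟨y, hy'⟩) :
    letI := galoisCohomology.moduleH1 (S.T.ρ k) (S.T.hlin k)
    ∃ e : ↥(S.selmerModuleAt hy k n) ≃ₗ[R] ((Fin ε → R ⧸ IsLocalRing.maximalIdeal R ^ S.e k) × (M × M)),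
      ∀ y : ↥(S.selmerModuleAt hy k n),
        e y = θ ⟨(y : galoisCohomology (S.T.ρ k) 1), (S.mem_selmerModuleAt_iff hy k n _).1 y.2⟩ := by
  letI := galoisCohomology.moduleH1 (S.T.ρ k) (S.T.hlin k)
  refine ⟨{ toFun := fun y => θ ⟨(y : galoisCohomology (S.T.ρ k) 1), (S.mem_selmerModuleAt_iff hy k n _).1 y.2⟩
            invFun := fun x => ⟨((θ.symm x : ↥((((S.t k).atLevel S.jbar n).cond).selmerGroup)) :
                galoisCohomology (S.T.ρ k) 1), (S.mem_selmerModuleAt_iff hy k n _).2 (θ.symm x).2⟩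
            map_add' := fun x y => by
              rw [← map_add]
              rfl
            map_smul' := fun r y => by
              rw [RingHom.id_apply, ← hθ r _ ((S.mem_selmerModuleAt_iff hy k n _).1 y.2)]
              rfl
            left_inv := fun y => by
              apply Subtype.ext
              change ((θ.symm (θ _) : ↥((((S.t k).atLevel S.jbar n).cond).selmerGroup)) :
                galoisCohomology (S.T.ρ k) 1) = _
              rw [AddEquiv.symm_apply_apply]
            right_inv := fun x => by
              change θ ⟨((θ.symm x : ↥((((S.t k).atLevel S.jbar n).cond).selmerGroup)) :
                galoisCohomology (S.T.ρ k) 1), (θ.symm x).2⟩ = x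
              rw [Subtype.coe_eta, AddEquiv.apply_symm_apply] }, fun y => rfl⟩

/-- **`len_R H¹_{F(n)}(K, T^{(k)}) = ε·e_k + 2·len_R M`** for a decomposition as above (`len_R(R/𝔪^{e_k}) = e_k`).
[cite: Howard2004HeegnerKolyvagin, Thm. 1.4.2 and Def. 1.5.4 (arXiv p. 8 L99–105, p. 10 L56–60)] -/
theorem length_selmerModuleAt_eq (S : DVRSetting p K R N Rk Nbar Nq) (hy : S.SatisfiesH) (k : ℕ)
    (n : Finset (HeightOneSpectrum (𝓞 K))) {ε : ℕ} {M : Type} [AddCommGroup M] [Module R M]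
    (θ : ↥((((S.t k).atLevel S.jbar n).cond).selmerGroup) ≃+
      ((Fin ε → R ⧸ IsLocalRing.maximalIdeal R ^ S.e k) × (M × M)))
    (hθ : ∀ (r : R) (y : galoisCohomology (S.T.ρ k) 1) (hy' : y ∈ (((S.t k).atLevel S.jbar n).cond).selmerGroup),
      θ ⟨galoisCohomology.scalarMapH1 (S.T.ρ k) (S.T.hlin k) r y,
          S.scalarMapH1_mem_selmerGroup_atLevel hy k n r hy'⟩ = r • θ ⟨y, hy'⟩) :
    letI := galoisCohomology.moduleH1 (S.T.ρ k) (S.T.hlin k)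
    Module.length R ↥(S.selmerModuleAt hy k n) =
      (ε : ℕ∞) * (S.e k : ℕ∞) + (Module.length R M + Module.length R M) := by
  letI := galoisCohomology.moduleH1 (S.T.ρ k) (S.T.hlin k)
  have hirr : Irreducible S.π := (IsDiscreteValuationRing.irreducible_iff_uniformizer S.π).mpr hy.unif
  obtain ⟨e, -⟩ := S.exists_linearEquiv_selmerModuleAt hy k n θ hθ
  have hCk : Module.length R (R ⧸ IsLocalRing.maximalIdeal R ^ S.e k) = S.e k := by
    have hI : IsLocalRing.maximalIdeal R ^ S.e k = Ideal.span {S.π ^ S.e k} := by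
      rw [hy.unif, Ideal.span_singleton_pow]
    rw [(Submodule.quotEquivOfEq _ _ hI).length_eq]
    exact Literature.Algebra.Module.length_quotient_uniformizer_pow hirr (S.e k)
  rw [e.length_eq, Module.length_prod, Module.length_prod, Module.length_pi_of_fintype, Finset.sum_const,
    Finset.card_univ, Fintype.card_fin, hCk, nsmul_eq_mul]

/-- `Stub^{(k)}(n) = 0` iff `π^{λ^{(k)}(n)}` kills `H¹_{F(n)}(K, T^{(k)})`.
[cite: Howard2004HeegnerKolyvagin, Def. 1.5.4 (arXiv p. 10, L58–60)] -/
theorem stub_eq_bot_iff (S : DVRSetting p K R N Rk Nbar Nq) (hy : S.SatisfiesH) (hdec : S.HasLevelDecompositions hy)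
    (k : ℕ) (n : Finset (HeightOneSpectrum (𝓞 K))) :
    letI := galoisCohomology.moduleH1 (S.T.ρ k) (S.T.hlin k)
    S.stub hy hdec k n = ⊥ ↔ ∀ y : ↥(S.selmerModuleAt hy k n), S.π ^ S.stubLength hy hdec k n • y = 0 := by
  letI := galoisCohomology.moduleH1 (S.T.ρ k) (S.T.hlin k)
  constructor
  · intro h y
    have hy' : S.π ^ S.stubLength hy hdec k n • y ∈ S.stub hy hdec k n := (S.mem_stub_iff hy hdec k n _).2 ⟨y, rfl⟩
    rw [h, Submodule.mem_bot] at hy'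
    exact hy'
  · intro h
    rw [Submodule.eq_bot_iff]
    intro x hx
    obtain ⟨y, rfl⟩ := (S.mem_stub_iff hy hdec k n x).1 hx
    exact h y

/-! ## §3 Lemma 1.3.3 at level `n`, read in lengths -/

/-- **The length lower bound from a higher level.**  Levels `i ≤ k`, `n ∈ 𝓝(𝓛^{(2k-1)})`, and a decomposition
`θ : H¹_{F(n)}(K, T^{(k)}) ≃ (Fin ε → R/𝔪^{e_k}) × (M × M)` with `π^{e_i} M = 0`.  Then
`ε·e_i + 2·len M ≤ len H¹_{F(n)}(K, T^{(i)})`: under `H¹(inc_{i→k})` (injective, `R`-equivariant) the group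
`H¹_{F(n)}(K, T^{(i)})` is the `𝔪^{e_i}`-torsion of `H¹_{F(n)}(K, T^{(k)})` (Lemma 1.3.3 at level `n`; the primes of
`n` act trivially on the levels `≤ k` since `I_n T^{(j)} = 0`), which contains `θ⁻¹((π^{e_k-e_i}R/𝔪^{e_k})^ε × M × M)
≅ (R/𝔪^{e_i})^ε × M × M`. [cite: Howard2004HeegnerKolyvagin, Lemma 1.3.3 with Lemma 1.5.1, Lemma 1.6.4 proof (arXiv p. 7 L152–160, p. 9 L127–133, p. 11 L85 – p. 12 L1)] [cite: MazurRubinMemoirs2004, Lemma 3.5.4] -/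
theorem length_selmerModuleAt_lower_bound (S : DVRSetting p K R N Rk Nbar Nq) (hy : S.SatisfiesH) {i k : ℕ}
    (hik : i ≤ k) (n : Finset (HeightOneSpectrum (𝓞 K))) (hn : ↑n ⊆ S.enginePrimes k)
    {ε : ℕ} {M : Type} [AddCommGroup M] [Module R M]
    (θ : ↥((((S.t k).atLevel S.jbar n).cond).selmerGroup) ≃+
      ((Fin ε → R ⧸ IsLocalRing.maximalIdeal R ^ S.e k) × (M × M)))
    (hθ : ∀ (r : R) (y : galoisCohomology (S.T.ρ k) 1) (hy' : y ∈ (((S.t k).atLevel S.jbar n).cond).selmerGroup),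
      θ ⟨galoisCohomology.scalarMapH1 (S.T.ρ k) (S.T.hlin k) r y,
          S.scalarMapH1_mem_selmerGroup_atLevel hy k n r hy'⟩ = r • θ ⟨y, hy'⟩)
    (hM : ∀ m : M, S.π ^ S.e i • m = 0) :
    letI := galoisCohomology.moduleH1 (S.T.ρ i) (S.T.hlin i)
    (ε : ℕ∞) * (S.e i : ℕ∞) + (Module.length R M + Module.length R M) ≤
      Module.length R ↥(S.selmerModuleAt hy i n) := by
  obtain ⟨d, rfl⟩ := Nat.exists_eq_add_of_le hik
  letI instI := galoisCohomology.moduleH1 (S.T.ρ i) (S.T.hlin i)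
  letI instK := galoisCohomology.moduleH1 (S.T.ρ (i + d)) (S.T.hlin (i + d))
  have hirr : Irreducible S.π := (IsDiscreteValuationRing.irreducible_iff_uniformizer S.π).mpr hy.unif
  have hπm : S.π ∈ IsLocalRing.maximalIdeal R := by rw [hy.unif]; exact Ideal.mem_span_singleton_self _
  have hle : ∀ j, S.e j ≤ S.e (j + 1) := fun j => hy.e_strictMono.monotone (Nat.le_succ j)
  have hei : S.e i ≤ S.e (i + d) := hy.e_strictMono.monotone (Nat.le_add_right i d)
  -- the primes of `n` act trivially on every level `≤ i + d`
  have htriv : ∀ j, j ≤ i + d → ∀ w ∈ n, ∀ g ∈ transverseFixer p (residueChar w) S.jbar w, ∀ y : N j,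
      GaloisRep.toLocal w (S.T.ρ j) g y = y :=
    fun j hj w hw g _ y => S.toLocal_apply_eq_self_of_ker_eq_bot hy j
      (S.mem_levelSet_of_subset_enginePrimes hy (i + d) j hn)
      (S.ker_π_eq_bot_of_subset_enginePrimes hy j (hn.trans (S.enginePrimes_antitone hy hj))) hw g y
  obtain ⟨eK, heK⟩ := S.exists_linearEquiv_selmerModuleAt hy (i + d) n θ hθ
  -- §1: `R/(π^{e_i}) ↪ R/𝔪^{e_{i+d}}`
  have hI : IsLocalRing.maximalIdeal R ^ S.e (i + d) = Ideal.span {S.π ^ S.e (i + d)} := by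
    rw [hy.unif, Ideal.span_singleton_pow]
  obtain ⟨ι, hι, hιa⟩ := exists_injective_linearMap_quotient_span_pow hirr.ne_zero hei _ hI
  -- the comparison map `c = θ ∘ H¹(inc_{i→i+d})` on `H¹_{F(n)}(K, T^{(i)})`
  have hmem : ∀ y : ↥(S.selmerModuleAt hy i n),
      AdicTower.incH1LE S.T S.π S.e hy.killed hy.ker_red hπm hle i (i + d) (Nat.le_add_right i d)
        (y : galoisCohomology (S.T.ρ i) 1) ∈ S.selmerModuleAt hy (i + d) n :=
    fun y => (S.mem_selmerModuleAt_iff hy (i + d) n _).2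
      ((S.incH1LE_mem_selmerGroup_atLevel_iff hy hπm hle n (i + d) htriv i d le_rfl _).2
        ((S.mem_selmerModuleAt_iff hy i n _).1 y.2))
  let c : ↥(S.selmerModuleAt hy i n) →ₗ[R]
      ((Fin ε → R ⧸ IsLocalRing.maximalIdeal R ^ S.e (i + d)) × (M × M)) :=
    { toFun := fun y => eK ⟨_, hmem y⟩
      map_add' := fun x y => by
        rw [← map_add]
        congr 1
        apply Subtype.ext
        change AdicTower.incH1LE S.T S.π S.e hy.killed hy.ker_red hπm hle i (i + d) (Nat.le_add_right i d)
          ((x : galoisCohomology (S.T.ρ i) 1) + y) = _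
        rw [map_add]
        rfl
      map_smul' := fun r y => by
        rw [RingHom.id_apply, ← map_smul]
        congr 1
        apply Subtype.ext
        change AdicTower.incH1LE S.T S.π S.e hy.killed hy.ker_red hπm hle i (i + d) (Nat.le_add_right i d)
          (galoisCohomology.scalarMapH1 (S.T.ρ i) (S.T.hlin i) r (y : galoisCohomology (S.T.ρ i) 1)) =
          galoisCohomology.scalarMapH1 (S.T.ρ (i + d)) (S.T.hlin (i + d)) r
            (AdicTower.incH1LE S.T S.π S.e hy.killed hy.ker_red hπm hle i (i + d) (Nat.le_add_right i d)
              (y : galoisCohomology (S.T.ρ i) 1))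
        have h := DFunLike.congr_fun
          (AdicTower.scalarMapH1_comp_incH1LE S.T S.π S.e hy.killed hy.ker_red hπm hle r i (i + d)
            (Nat.le_add_right i d)) (y : galoisCohomology (S.T.ρ i) 1)
        rw [AddMonoidHom.comp_apply, AddMonoidHom.comp_apply] at h
        exact h.symm }
  have hc : Function.Injective c := by
    intro x y hxy
    have h1 := eK.injective hxy
    rw [Subtype.ext_iff] at h1
    exact Subtype.ext (S.incH1LE_injective hy hπm hle i (i + d) (Nat.le_add_right i d) h1)
  -- the witness module `(Fin ε → R/(π^{e_i})) × (M × M)` and its injection `ψ` into level `i + d`'s target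
  let ψ : ((Fin ε → R ⧸ Ideal.span {S.π ^ S.e i}) × (M × M)) →ₗ[R]
      ((Fin ε → R ⧸ IsLocalRing.maximalIdeal R ^ S.e (i + d)) × (M × M)) :=
    (ι.compLeft (Fin ε)).prodMap LinearMap.id
  have hψ : Function.Injective ψ := by
    rintro ⟨f₁, m₁⟩ ⟨f₂, m₂⟩ h
    rw [LinearMap.prodMap_apply, LinearMap.prodMap_apply, Prod.mk.injEq] at h
    obtain ⟨h1, h2⟩ := h
    refine Prod.ext ?_ (by simpa using h2)
    funext j
    exact hι (congrFun h1 j)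
  -- every `ψ`-value is killed by `π^{e_i}`, hence lies in `c(H¹_{F(n)}(K, T^{(i)}))` (Lemma 1.3.3 at level `n`)
  have hkill : ∀ x, S.π ^ S.e i • ψ x = 0 := by
    rintro ⟨f, m₁, m₂⟩
    rw [LinearMap.prodMap_apply, Prod.smul_mk, Prod.mk_eq_zero]
    refine ⟨?_, ?_⟩
    · funext j
      exact hιa (f j)
    · rw [LinearMap.id_apply, Prod.smul_mk, Prod.mk_eq_zero]
      exact ⟨hM m₁, hM m₂⟩
  have hrange : ∀ x, ψ x ∈ LinearMap.range c := by
    intro x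
    set z : ↥(S.selmerModuleAt hy (i + d) n) := eK.symm (ψ x) with hz
    have hz0 : S.π ^ S.e i • z = 0 := by
      apply eK.injective
      rw [map_smul, hz, LinearEquiv.apply_symm_apply, map_zero, hkill]
    have hz0' : galoisCohomology.scalarMapH1 (S.T.ρ (i + d)) (S.T.hlin (i + d)) (S.π ^ S.e i)
        (z : galoisCohomology (S.T.ρ (i + d)) 1) = 0 := by
      have := congrArg Subtype.val hz0
      exact this
    obtain ⟨c₀, hc₀, hc₀z⟩ := S.exists_mem_selmerGroup_atLevel_incH1LE_eq hy hπm hle n (i + d) htriv i d le_rfl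
      (z : galoisCohomology (S.T.ρ (i + d)) 1) ((S.mem_selmerModuleAt_iff hy (i + d) n _).1 z.2) hz0'
    refine ⟨⟨c₀, (S.mem_selmerModuleAt_iff hy i n _).2 hc₀⟩, ?_⟩
    change eK ⟨_, hmem _⟩ = ψ x
    have h2 : (⟨_, hmem ⟨c₀, (S.mem_selmerModuleAt_iff hy i n _).2 hc₀⟩⟩ : ↥(S.selmerModuleAt hy (i + d) n)) = z :=
      Subtype.ext hc₀z
    rw [h2, hz, LinearEquiv.apply_symm_apply]
  -- lengths
  have hCi : Module.length R (R ⧸ Ideal.span {S.π ^ S.e i}) = S.e i :=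
    Literature.Algebra.Module.length_quotient_uniformizer_pow hirr (S.e i)
  have hF : Module.length R ((Fin ε → R ⧸ Ideal.span {S.π ^ S.e i}) × (M × M)) =
      (ε : ℕ∞) * (S.e i : ℕ∞) + (Module.length R M + Module.length R M) := by
    rw [Module.length_prod, Module.length_prod, Module.length_pi_of_fintype, Finset.sum_const, Finset.card_univ,
      Fintype.card_fin, hCi, nsmul_eq_mul]
  let g : ((Fin ε → R ⧸ Ideal.span {S.π ^ S.e i}) × (M × M)) →ₗ[R] ↥(S.selmerModuleAt hy i n) :=
    (LinearEquiv.ofInjective c hc).symm.toLinearMap ∘ₗ (ψ.codRestrict (LinearMap.range c) hrange)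
  have hg : Function.Injective g := by
    refine (LinearEquiv.ofInjective c hc).symm.injective.comp ?_
    intro x y hxy
    apply hψ
    have := congrArg Subtype.val hxy
    simpa using this
  rw [← hF]
  exact Module.length_le_of_injective g hg

/-! ## §4 «`λ^{(i)}(n) = λ^{(k)}(n) = i`, and so `Stub^{(i)}(n) = 0`» -/

/-- **Howard's first case of Lemma 1.6.4, the lower stub vanishes**: for `i ≤ k`, `n ∈ 𝓝(𝓛^{(2k-1)})`,
`Stub^{(k)}(n) ≠ 0` and `λ^{(k)}(n) = e_i`, one has `Stub^{(i)}(n) = 0`.  (`Stub^{(k)}(n) ≠ 0` forces `ε = 1` and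
`π^{e_i} M^{(k)}(n) = 0`; by §3 and the length of level `i`'s own decomposition, `ε_i e_i + 2λ^{(i)}(n) ≥ 3e_i`, so
`λ^{(i)}(n) ≥ e_i` and `π^{λ^{(i)}(n)}` kills `H¹_{F(n)}(K, T^{(i)})`.)
[cite: Howard2004HeegnerKolyvagin, Lemma 1.6.4 proof, first case (arXiv p. 11 L85 – p. 12 L1)] -/
theorem stub_eq_bot_of_stubLength_eq_e (S : DVRSetting p K R N Rk Nbar Nq) (hy : S.SatisfiesH)
    (hdec : S.HasLevelDecompositions hy) {i k : ℕ} (hik : i ≤ k) (n : Finset (HeightOneSpectrum (𝓞 K)))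
    (hn : ↑n ⊆ S.enginePrimes k) (hst : S.stub hy hdec k n ≠ ⊥) (hlam : S.stubLength hy hdec k n = S.e i) :
    S.stub hy hdec i n = ⊥ := by
  letI instI := galoisCohomology.moduleH1 (S.T.ρ i) (S.T.hlin i)
  letI instK := galoisCohomology.moduleH1 (S.T.ρ k) (S.T.hlin k)
  have hπm : S.π ∈ IsLocalRing.maximalIdeal R := by rw [hy.unif]; exact Ideal.mem_span_singleton_self _
  have hni : ↑n ⊆ S.enginePrimes i := hn.trans (S.enginePrimes_antitone hy hik)
  obtain ⟨ε, hε, M, _, _, _, θ, hθ, hlen⟩ := S.exists_decomposition_stubLength_eq hy hdec k hn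
  obtain ⟨εi, hεi, Mi, _, _, _, θi, hθi, hleni⟩ := S.exists_decomposition_stubLength_eq hy hdec i hni
  haveI : IsArtinian R M := isArtinian_of_finite
  haveI : IsArtinian R Mi := isArtinian_of_finite
  -- `π^{e_i} = π^{len M}` kills `M`
  have hM : ∀ m : M, S.π ^ S.e i • m = 0 := fun m => by
    rw [← hlam, hlen]
    exact smul_eq_zero_of_mem_maximalIdeal_pow_length (Ideal.pow_mem_pow hπm _) m
  -- `ε = 1`: otherwise `π^{λ^{(k)}(n)}` kills the whole decomposition and `Stub^{(k)}(n) = 0`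
  obtain ⟨eK, heK⟩ := S.exists_linearEquiv_selmerModuleAt hy k n θ hθ
  have hε1 : ε = 1 := by
    by_contra hne
    have hε0 : ε = 0 := by omega
    subst hε0
    apply hst
    rw [S.stub_eq_bot_iff hy hdec k n]
    intro y
    apply eK.injective
    rw [map_smul, map_zero, hlen]
    exact stub_subsingleton_of_free_part_subsingleton (Ideal.pow_mem_pow hπm _) (eK y)
  subst hε1
  -- the length count at level `i`
  have hlow := S.length_selmerModuleAt_lower_bound hy hik n hn θ hθ hM
  have hLi := S.length_selmerModuleAt_eq hy i n θi hθi
  have hMlen : Module.length R M = ((S.e i : ℕ) : ℕ∞) := by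
    rw [← ENat.coe_toNat (Module.length_ne_top (R := R) (M := M)), ← hlen, hlam]
  have hMi : Module.length R Mi = (((Module.length R Mi).toNat : ℕ) : ℕ∞) :=
    (ENat.coe_toNat (Module.length_ne_top (R := R) (M := Mi))).symm
  rw [hLi, hMlen, hMi, Nat.cast_one, one_mul] at hlow
  have hnat : S.e i + (S.e i + S.e i) ≤ εi * S.e i + ((Module.length R Mi).toNat + (Module.length R Mi).toNat) := by
    exact_mod_cast hlow
  have hεle : εi * S.e i ≤ 1 * S.e i := Nat.mul_le_mul_right _ hεi
  have hge : S.e i ≤ (Module.length R Mi).toNat := by omega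
  -- `Stub^{(i)}(n) = π^{λ^{(i)}(n)} H = 0`
  rw [S.stub_eq_bot_iff hy hdec i n]
  intro y
  rw [hleni, ← Nat.sub_add_cancel hge, pow_add, mul_smul]
  have h0 : S.π ^ S.e i • y = 0 := Subtype.ext (S.pow_e_smul_eq_zero hy i (y : galoisCohomology (S.T.ρ i) 1))
  rw [h0, smul_zero]

/-! ## §5 The engine binder `hlam` on a FULL setting -/

/-- **ENGINE-hlam on a full `DVRSetting`** (`e_j = j + 1`): for `n ∈ 𝓝(𝓛^{(2k-1)})` with `Stub^{(k)}(n) ≠ 0`, either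
`Stub^{(k)}(n) = H¹_{F(n)}(K, T^{(k)})` (`λ^{(k)}(n) = 0`), or the level `i = λ^{(k)}(n) - 1` (the level of exponent
`λ^{(k)}(n)`; Howard's `i = λ^{(k)}(n) < k`) satisfies `i < k` and `Stub^{(i)}(n) = 0`.
[cite: Howard2004HeegnerKolyvagin, Lemma 1.6.4 proof, first case (arXiv p. 11 L85 – p. 12 L1)] -/
theorem stub_eq_top_or_stub_stubLength_pred_eq_bot (S : DVRSetting p K R N Rk Nbar Nq) (hy : S.SatisfiesH)
    (hfull : ∀ j, S.e j = j + 1) (hdec : S.HasLevelDecompositions hy) (k : ℕ)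
    (n : Finset (HeightOneSpectrum (𝓞 K))) (hn : ↑n ⊆ S.enginePrimes k) (hst : S.stub hy hdec k n ≠ ⊥) :
    S.stub hy hdec k n = ⊤ ∨
      (S.stubLength hy hdec k n - 1 < k ∧ S.stub hy hdec (S.stubLength hy hdec k n - 1) n = ⊥) := by
  letI instK := galoisCohomology.moduleH1 (S.T.ρ k) (S.T.hlin k)
  by_cases h0 : S.stubLength hy hdec k n = 0
  · left
    refine eq_top_iff.2 fun x _ => (S.mem_stub_iff hy hdec k n x).2 ⟨x, ?_⟩
    rw [h0, pow_zero, one_smul]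
  · right
    -- `λ^{(k)}(n) < e_k = k + 1`, since `π^{e_k}` kills everything
    have hlt : S.stubLength hy hdec k n < S.e k := by
      by_contra hge
      push Not at hge
      apply hst
      rw [S.stub_eq_bot_iff hy hdec k n]
      intro y
      rw [← Nat.sub_add_cancel hge, pow_add, mul_smul]
      have h1 : S.π ^ S.e k • y = 0 := Subtype.ext (S.pow_e_smul_eq_zero hy k (y : galoisCohomology (S.T.ρ k) 1))
      rw [h1, smul_zero]
    rw [hfull k] at hlt
    refine ⟨by omega, S.stub_eq_bot_of_stubLength_eq_e hy hdec (by omega) n hn hst ?_⟩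
    rw [hfull]
    omega

/-- **The engine binder `hlam` VERBATIM** (the `lam` slot of `mem_stub_of_stubLemmaInduction_levels'` filled with
`fun k n => S.stubLength hy hdec k n - 1`, `P := S.enginePrimes`, `Stub := S.stub hy hdec`), on a full `DVRSetting`
with H.0–H.5 and levelwise decompositions. [cite: Howard2004HeegnerKolyvagin, Lemma 1.6.4 proof, first case (arXiv p. 11 L85 – p. 12 L1)] -/
theorem engine_hlam (S : DVRSetting p K R N Rk Nbar Nq) (hy : S.SatisfiesH) (hfull : ∀ j, S.e j = j + 1)
    (hdec : S.HasLevelDecompositions hy) :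
    ∀ (k : ℕ) (n : Finset (HeightOneSpectrum (𝓞 K))), ↑n ⊆ S.enginePrimes k → S.stub hy hdec k n ≠ ⊥ →
      S.stub hy hdec k n = ⊤ ∨
        ((fun k n => S.stubLength hy hdec k n - 1) k n < k ∧
          S.stub hy hdec ((fun k n => S.stubLength hy hdec k n - 1) k n) n = ⊥) :=
  fun k n hn hst => S.stub_eq_top_or_stub_stubLength_pred_eq_bot hy hfull hdec k n hn hst

end DVRSetting

end Literature.NumberTheory.GaloisCohomology.Howard2004

end
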